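import Summits.KontsevichZagierPeriods.KontsevichZagierPeriods.Theorems.HurwitzMicroSectorsHurwitzSectorComplementStubLadderDescent
import Summits.KontsevichZagierPeriods.KontsevichZagierPeriods.Theorems.HurwitzMicroSectorsHurwitzSectorComplementStubLadderEngine
import Summits.KontsevichZagierPeriods.KontsevichZagierPeriods.Theorems.HurwitzMicroSectorsHurwitzSectorComplementStubArcSimplex
import Summits.KontsevichZagierPeriods.KontsevichZagierPeriods.Theorems.HurwitzMicroSectorsHurwitzSectorComplementStubBottomCell
import Summits.KontsevichZagierPeriods.KontsevichZagierPeriods.Theorems.HurwitzMicroSectorsHurwitzSectorComplementStubAssemblyCalc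
import Summits.KontsevichZagierPeriods.KontsevichZagierPeriods.Theorems.HurwitzMicroSectorsHurwitzSectorComplementStubPartialFractions

/-!
# `HurwitzSectorComplement` (stmt-KontsevichZagierPeriods-14341, route HurwitzMicroSectors),
# line `chebyshev-level-deformation`: the PARITY TOWER SECTOR (the line's headline theorem)

Conjecture 1 of Kontsevich–Zagier on the real-algebraic span of the Bernoulli-parity (symmetric)
Hurwitz tower: any two box representations `[(0,1)^w, Q(t) + R(t)/(1 − t^N)]`, `t = x₁⋯x_w`,
`Q, R ∈ ℝ[X]` with real-ALGEBRAIC coefficients, `R` `(−1)^w`-symmetric of degree `< N`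
(`R_{N−1} = 0` for odd `w`), all `w, w' ≥ 2`, `N, N' ≥ 1`, with equal values are KZ-equivalent.
This is the composition of the registered skeleton of lead c1 (`Lines/chebyshev_level_deformation.lean`),
all of whose provable stubs are now in the tree: the ladder engine S1 (`stub_ladderEngine`), the arc
simplices S2a (`stub_arcSimplex`), the bottom cell S2b (`stub_bottomCell`), the four descents S3
(`stub_ladderDescent`), the real-cyclotomic partial fractions S4 (`stub_partialFractions`) and the
assembly S5 (`stub_assembly`). The remaining stub S6 `stub_spliceRemainder : parityTowerSector →
NormalFormPrinciple` is the declared summit-strength remainder (Disproof.lean `crux_iff_summit`).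
Reference: M. Kontsevich, D. Zagier, *Periods* (2001), §1.2 Conjecture 1.
-/

noncomputable section

open Set MeasureTheory
open scoped BigOperators
open Literature.NumberTheory.Transcendental

namespace Summit.KontsevichZagierPeriods.Theorems.HurwitzMicroSectorsHurwitzSectorComplement

/-- **The parity tower sector** (registered stub `parityTowerSector` of line
`chebyshev-level-deformation`): Conjecture 1 for all pairs of real-algebraic symmetric box
representations `[(0,1)^w, Q(t) + R(t)/(1 − t^N)]` across weights and levels — equal values imply
KZ-equivalence. Composition of S1–S5 exactly as in the registered skeleton.
[cite: KontsevichZagier2001, §1.2 Conjecture 1] -/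
theorem parityTowerSector :
    ∀ (w N w' N' : ℕ), 2 ≤ w → 1 ≤ N → 2 ≤ w' → 1 ≤ N' →
      ∀ (r : KZ.IntegralRep w) (r' : KZ.IntegralRep w'),
      (∃ (Q R : Polynomial ℝ), (∀ i, IsAlgebraic ℚ (Q.coeff i)) ∧ (∀ i, IsAlgebraic ℚ (R.coeff i)) ∧
        R.natDegree < N ∧ (∀ i j : ℕ, i + j + 2 = N → R.coeff i = (-1 : ℝ) ^ w * R.coeff j) ∧
        (Odd w → R.coeff (N - 1) = 0) ∧ r.domain = {x | ∀ i, x i ∈ Set.Ioo (0:ℝ) 1} ∧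
        Set.EqOn r.integrand (fun x => Polynomial.eval (∏ i, x i) Q +
          Polynomial.eval (∏ i, x i) R / (1 - (∏ i, x i) ^ N)) r.domain) →
      (∃ (Q R : Polynomial ℝ), (∀ i, IsAlgebraic ℚ (Q.coeff i)) ∧ (∀ i, IsAlgebraic ℚ (R.coeff i)) ∧
        R.natDegree < N' ∧ (∀ i j : ℕ, i + j + 2 = N' → R.coeff i = (-1 : ℝ) ^ w' * R.coeff j) ∧
        (Odd w' → R.coeff (N' - 1) = 0) ∧ r'.domain = {x | ∀ i, x i ∈ Set.Ioo (0:ℝ) 1} ∧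
        Set.EqOn r'.integrand (fun x => Polynomial.eval (∏ i, x i) Q +
          Polynomial.eval (∏ i, x i) R / (1 - (∏ i, x i) ^ N')) r'.domain) →
      r.value = r'.value → KZ.Equivalent r r' :=
  stub_assembly (stub_ladderDescent stub_ladderEngine stub_arcSimplex
    (stub_bottomCell stub_arcSimplex.1 stub_arcSimplex.2)) stub_partialFractions

end Summit.KontsevichZagierPeriods.Theorems.HurwitzMicroSectorsHurwitzSectorComplement

end
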